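import Summits.QuantumFields.YangMills.Theorems.BalabanUVNodesN06Delta2AtPinsPhysPQ
import Literature.MathematicalPhysics.QuantumFieldTheory.Balaban1983to89.B9Eq3136HstarJAtPinsLetterFamilyPt

/-!
# BalabanUVNodes ∕ N06 ([B9], `Dag.B9_main`) — R1 J-TWIN 3∕≈18: THE (3.137) ROAD `hD2sup ⟸ hC2 + hreg + hGDsup + hCsup` OVER A GENERIC AVERAGING PAIR
# `(𝔮, 𝔮⋆)` AND A SITE TRANSPORTER `parT`, ALONG A SUB-FAMILY `f : J → MemberY …` — the J-twin of ✓`…N06Delta2AtPinsPhysPQ` (dag-n06-l g38, P-D2-knit leg T-c)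

Track A of `YM-PLAN.md` (cell `pub-ymgap`, HUMAN RULING D-0062), node **N06** = [Balaban1985BackgroundPropagators]; IR-N06-SECTION-2 road **R1** («J-twin of the
producer cone», ★★★ director-ym №524 (3): authorised in principle, STAGED, sibling files only, one file on a by-name ask), dag-n06-d's `R1-JTWIN-SPEC.md` rule (R)′
(2026-08-31): re-key EXACTLY the section-tainted ∀-member rows along `f`, keep data ∕ pins ∕ laws ∕ section-free rows member-wide, conclusions along `f`.
Seat `pub-ymgap-dag-n06-l` g41 (R1 ORDER: a LEAF of the n06-l chain — no Summits callee; consumer to come: `…N06D2SupLegAtPinsPUWQ`ᴶ).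

WHAT.  The three theorems of the parent with an index type `J` and a map `f : J → MemberY θ.d₆ θ.ℓ₆ θ.hd' θ.hL' θ.b₀ θ.b₁ Mstar` added after the `H` binder and
* TAINTED ROWS OF THIS TWIN (provenance through rows 15∕16∕17 at the head: `hGDsup` ⟸ the `G̃[𝔮]` sup letter of P-D2-knit (7) ⟸ the state layer ⟸ (3.49) `h49` ⟸ (3.48)
  `h348`; `hCsup` ⟸ the weighted (3.132) letter of `C[𝔮]` ⟸ `CoerciveUnder` ⟸ ROW 17 `hΔ`): `hD2sup_of_form_schemas_wRPQ_J` re-keys `hHJ` (the `(H\*J)` letter, produced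
  inside `…_sq_q_J` from `hGDsup hCsup`); `hHT_of_GD_C_lettersRP_sq_q_J` and `hD2sup_of_GD_C_lettersRP_sq_q_J` re-key `hGDsup hCsup` — `∀ x : MemberY … ↦ ∀ j : J`, read at `f j`;
* LEFT member-wide: the letter families `𝔮 𝔮⋆ parT 𝔬12 bI wC wH WC 𝔠`, the pins `hblk12 hbI0 hblkZ12`, the laws `hadj hGD hQ15 hreg` ((3.35)-adjointness of the pair, symmetry
  of `G̃[𝔮]`, the (3.15) block law, r06's cube covering) and the SECTION-FREE row `hC2` ([5] (149), def-Y's torus letters);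
* conclusions `∃ ML, ∀ j : J, … (f j) …` (rule (R)′.3);
* the one family-wide Literature callee of the parent, dag-n08-d's `B9Eq3136HstarJAtPinsLetterFamily.norm_trAdjY_JY_le_of_transpose_schemas_wR` (rows `hOT hreg` asked
  over the whole member family), is read through its POINTWISE face `B9Eq3136HstarJAtPinsLetterFamilyPt.norm_trAdjY_JY_le_of_transpose_schemas_wR_pt` (rows asked at
  the point; this seat, sibling file), fed `hHT j` and `hreg (f j)` at the member `f j`.
PROOF: the parent's texts by generator (`mkJ8.py` over the tree bytes): `fun x ↦ fun j`, member reads `x ↦ f j`, tainted applications `h x ↦ h j`; nothing re-derived.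
The member-wide parent is the instance `J := MemberY …`, `f := id`.  Until `…N06D2SupLegAtPinsPUWQ`ᴶ lands this file is an ORPHAN by design (honest).
HONEST FRAMING: kernel bookkeeping re-indexed; every analytic member a HYPOTHESIS of printed species; COUNT-NEUTRAL (`--supports stmt-QuantumFields-27239 --as helper`);
N06 NOT discharged; under R1 the inner-corner question stays DISPLAYED at the K1 face ∕ NODE O join by (α5); nothing continuum ∕ OS ∕ mass gap ∕ Clay.  0 `def`,
0 `sorry`.  NEW file; the parent untouched.
[cite: Balaban1985BackgroundPropagators, (3.134)–(3.137) pp.422–423, (3.126) p.420, (3.130) p.421, (3.132)–(3.133) p.422, (3.115) p.418, (3.13)–(3.15) pp.392–393, (3.36) p.396, p.398;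
Balaban1985Averaging, (149) p.40; Balaban1984PropagatorsII, (2.51) p.232, (2.54), Lemma 2.1 (2.60)–(2.61) pp.233–234]
-/

noncomputable section

namespace Summit.QuantumFields.YangMills.BalabanUVNodes.N06Delta2AtPinsPhysPQJ


open Literature.MathematicalPhysics.QuantumFieldTheory.Balaban1983to89
open Literature.MathematicalPhysics.QuantumFieldTheory.Balaban1983to89.Node00 (CfgY FBondY IBondY GpY parSymY parBY trDualMatY trAdjY JY Stage3Params C2Y
  resYOfC2 resYOfC2_Δ2 resYOfC2_Δ2_isSymmTr)
open Literature.MathematicalPhysics.QuantumFieldTheory.Balaban1983to89.B9Eq3132SectDLetters (HDY) open Literature.MathematicalPhysics.QuantumFieldTheory.Balaban1983to89.B9Thm34Ext (toB6) open Literature.MathematicalPhysics.QuantumFieldTheory.Balaban1983to89.B11SectG (RowSum)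
open Literature.MathematicalPhysics.QuantumFieldTheory.Balaban1983to89.B6RandomWalk (HasMajorant hasMajorant_mono) open Literature.MathematicalPhysics.QuantumFieldTheory.Balaban1983to89.B9SectDL2Decay (BlockBd) open Literature.MathematicalPhysics.QuantumFieldTheory.Balaban1983to89.B9Thm312Whole (GeoOK)
open Literature.MathematicalPhysics.QuantumFieldTheory.Balaban1983to89.B9RWSums343to347Whole (Facts347) open Literature.MathematicalPhysics.QuantumFieldTheory.Balaban1983to89.B9RWSumsDefinitePins (PinPrims) open Literature.MathematicalPhysics.QuantumFieldTheory.Balaban1983to89.B9RWSums347DefiniteFaces (exp261 lemma21Pack_geo9Y)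
open Literature.MathematicalPhysics.QuantumFieldTheory.Balaban1983to89.B9RowSum261DefiniteFaces (rowConst261 rowConst261_nonneg rowConst261_spec_of_rowSum261) open Literature.MathematicalPhysics.QuantumFieldTheory.Balaban1983to89.B9RWSums346Schur (scaleTransfer_len_rpow) open Literature.MathematicalPhysics.QuantumFieldTheory.Balaban1983to89.B9PinMembersKLevelV1 (MemberY geo9Y bg9Y)
open Literature.MathematicalPhysics.QuantumFieldTheory.Balaban1983to89.B9BackgroundsKLevelV1R (RegFamY bg9YR MemOfFam) open Literature.MathematicalPhysics.QuantumFieldTheory.Balaban1983to89.B9GeoLemma21KLevelV1 (geo9Y_len_pos geo9Y_dist_triangle geo9Y_dist_comm rowSum261_geo9Y) open Literature.MathematicalPhysics.QuantumFieldTheory.Balaban1983to89.B9GeoNormsKLevelV1 (geo9K_dist_nonneg)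
open Literature.MathematicalPhysics.QuantumFieldTheory.Balaban1983to89.B7Prop2SpecialUnitary (specialUnitaryUnits specialUnitaryUnits_le_unitaryUnits) open Literature.MathematicalPhysics.QuantumFieldTheory.Balaban1983to89.B9CoReadingCoords (XBK blkBK) open Literature.MathematicalPhysics.QuantumFieldTheory.Balaban1983to89.B9CoReadingCoordsH (XHK)
open Literature.MathematicalPhysics.QuantumFieldTheory.Balaban1983to89.B9CoReadingCoordsS (XSK) open Literature.MathematicalPhysics.QuantumFieldTheory.Balaban1983to89.B9CoReadingCoordsTranspose (TrIdx trBasis) open Literature.MathematicalPhysics.QuantumFieldTheory.Balaban1983to89.B9Thm39ReadingCoords (cR39 basisBound39)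
open Literature.MathematicalPhysics.QuantumFieldTheory.Balaban1983to89.Node00.OpsYSectDCoords (cR39_trBasis_pos) open Literature.MathematicalPhysics.QuantumFieldTheory.Balaban1983to89.B9PerturbationL2Delta2 (D2coK blockBd_d2coK_of_sup_symm) open Literature.MathematicalPhysics.QuantumFieldTheory.Balaban1983to89.B9Delta2FormMajorant (C2FormMaj hasMajorant_coordOpK_delta2OfY)
open scoped Matrix.Norms.L2Operator
open Literature.MathematicalPhysics.QuantumFieldTheory.Balaban1983to89.Node00 (CfgY FBondY IBondY GpY parSymY parBY trDualMatY trAdjY JY Stage3Params C2Y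
  resYOfC2 etaBY)
open Literature.MathematicalPhysics.QuantumFieldTheory.Balaban1983to89.Node00.OpsYSectDCoords (QcoKH CcoK cR39_trBasis_pos) open Literature.MathematicalPhysics.QuantumFieldTheory.Balaban1983to89.B9Eq3132SectDLetters (GDY HDY) open Literature.MathematicalPhysics.QuantumFieldTheory.Balaban1983to89.B6RandomWalk (HasMajorant Ineq261)
open Literature.MathematicalPhysics.QuantumFieldTheory.Balaban1983to89.B6RandomWalkHom (HasMajorantHom) open Literature.MathematicalPhysics.QuantumFieldTheory.Balaban1983to89.B9Thm37Glue (IsTransposePair) open Literature.MathematicalPhysics.QuantumFieldTheory.Balaban1983to89.B9RowSum261DefiniteFaces (rowConst261)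
open Literature.MathematicalPhysics.QuantumFieldTheory.Balaban1983to89.B9PinGeometryKLevelV1 (c35Y) open Literature.MathematicalPhysics.QuantumFieldTheory.Balaban1983to89.B9GeoLemma21KLevelV1 (geo9Y_len_pos geo9Y_dist_triangle) open Literature.MathematicalPhysics.QuantumFieldTheory.Balaban1983to89.B9BackgroundsKLevelV1 (shiftsV1 mem_of_reg335)
open Literature.MathematicalPhysics.QuantumFieldTheory.Balaban1983to89.B9CoReadingCoords (XBK blkBK GcoK) open Literature.MathematicalPhysics.QuantumFieldTheory.Balaban1983to89.B9CoReadingCoordsH (XHK blkHK HcoK) open Literature.MathematicalPhysics.QuantumFieldTheory.Balaban1983to89.B9Thm39ReadingCoords (basisBound39)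
open Literature.MathematicalPhysics.QuantumFieldTheory.Balaban1983to89.B9QstarLettersAtPins (parBY_norm_le_one_of_reg335) open Literature.MathematicalPhysics.QuantumFieldTheory.Balaban1983to89.B9Eq336CurrentBound (RegularAt) open Literature.MathematicalPhysics.QuantumFieldTheory.Balaban1983to89.B6GlobalChartV1 (PV blkV1)
open Literature.MathematicalPhysics.QuantumFieldTheory.Balaban1983to89.B6Ineq2142KLevelV1 (β) open Literature.MathematicalPhysics.QuantumFieldTheory.Balaban1983to89.B6Geom246MultiLevelTorus (geomT) open Literature.MathematicalPhysics.QuantumFieldTheory.Balaban1983to89.B9GeoNormsKLevelV1 (geo9K)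
open Literature.MathematicalPhysics.QuantumFieldTheory.Balaban1983to89.B9Eq3126HTransposeCoords (isTransposePair_HcoK_HDY_parSymY hasMajorantHom_CQG_of_letters) open Summit.QuantumFields.YangMills.BalabanUVNodes.N06HstarJAtPinsWPhysR (hHJ_of_transpose_schemas_wR hD2sup_of_transpose_schemas_wR) open Literature.MathematicalPhysics.QuantumFieldTheory.Balaban1983to89.B9BackgroundsKLevelV1R (RegFamY bg9YR MemOfFam regYP335 regYP336 memOfFam_regYP335)
open Literature.MathematicalPhysics.QuantumFieldTheory.Balaban1983to89.B9BackgroundsKLevelV1P (bg9YP) open Literature.MathematicalPhysics.QuantumFieldTheory.Balaban1983to89.B7Prop2SpecialUnitary (specialUnitaryUnits_le_U1) open Literature.MathematicalPhysics.QuantumFieldTheory.Balaban1983to89.B9Eq336RegularAtAllBondsP (regularAt_pinScale_of_regYP336)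
open Literature.MathematicalPhysics.QuantumFieldTheory.Balaban1983to89.Node00 (delta2OfY GpPhysY etaBY) open Literature.MathematicalPhysics.QuantumFieldTheory.Balaban1983to89.B9Eq3126HTransposeCoords (isTransposePair_HcoK_HDY_physY) open Literature.MathematicalPhysics.QuantumFieldTheory.Balaban1983to89.B9Eq3136HstarJAtPinsLetterFamily (norm_trAdjY_JY_le_of_transpose_schemas_wR)
open Literature.MathematicalPhysics.QuantumFieldTheory.Balaban1983to89.B9Eq3126HTransposeScaledMajorant (hasMajorantHom_CQG_of_letters_sq) open Literature.MathematicalPhysics.QuantumFieldTheory.Balaban1983to89.B9RWSums347DefiniteFaces (facts347_exp261_geo9Y) open Literature.MathematicalPhysics.QuantumFieldTheory.Balaban1983to89.B9GeoLemma21KLevelV1 (rowSum261_geo9Y geo9Y_dist_comm geo9Y_len_pos)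

open Literature.MathematicalPhysics.QuantumFieldTheory.Balaban1983to89.Node00 (HDQY GDQY delta2OfQY SiteParY) open Literature.MathematicalPhysics.QuantumFieldTheory.Balaban1983to89.Node00.OpsYOps312OfRecordPar (QcoKHq CcoKq) open Literature.MathematicalPhysics.QuantumFieldTheory.Balaban1983to89.B9Thm311ReadingCoords (IsAdjTr IsSymmTr)
open Literature.MathematicalPhysics.QuantumFieldTheory.Balaban1983to89.B9Eq3126HTransposeCoordsQ (isTransposePair_HcoK_HDQY hasMajorantHom_CQG_of_letters_sq_q) open Literature.MathematicalPhysics.QuantumFieldTheory.Balaban1983to89.B9Delta2FormMajorantH (hasMajorant_coordOpK_delta2OfHY) open Literature.MathematicalPhysics.QuantumFieldTheory.Balaban1983to89.B9RowSum261DefiniteFaces (rowConst261_nonneg rowConst261_spec_of_rowSum261)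

variable {N : ℕ} [NeZero N] {θ : Stage3Params} {Mstar : ℕ}
variable [∀ x : MemberY θ.d₆ θ.ℓ₆ θ.hd' θ.hL' θ.b₀ θ.b₁ Mstar, Fintype (geo9Y x).Site]

/-- the kernel domination: `r·(…·(t·θ)·…)·W·e ≤ θ₂·θ·W·e` once `r·(…·t·…) ≤ θ₂` and `θ, W, e ≥ 0`. [cite: Balaban1985BackgroundPropagators, (3.137) p.423, bookkeeping] -/
private theorem kernel_dom {r n b κ t θ C c θ₂ W e : ℝ} (h : r * (n * b * κ * t * C * c) ≤ θ₂) (hθ : 0 ≤ θ) (hW : 0 ≤ W) (he : 0 ≤ e) :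
    r * (n * b * κ * (t * θ) * C * c) * W * e ≤ θ₂ * θ * W * e := by
  have h1 : r * (n * b * κ * (t * θ) * C * c) * W * e = (r * (n * b * κ * t * C * c)) * (θ * (W * e)) := by ring
  rw [h1, show θ₂ * θ * W * e = θ₂ * (θ * (W * e)) by ring]
  exact mul_le_mul_of_nonneg_right h (mul_nonneg hθ (mul_nonneg hW he))

/-- ★★ (GpPhysY TWIN of n06-w8's `…N06Delta2AtPinsC2PhysR.hD2sup_of_form_schemas_wR`; statement and proof verbatim with `GpY ↦ GpPhysY` and the residual written as the explicit `delta2OfY … GpPhysY …` term = def-Y's `resYOfC2P … 𝔠` by `resYOfC2P_Δ2`) **`hD2sup` FOR ANY WEIGHT SPLIT, AT `G′_phys`**: as `hD2sup_of_form_schemas`, with the form letter at a free weight family `w_C` and the current letter at a free weight family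
`w_H`, `0 ≦ w_C, w_H`, `w_C(c)·w_H(c) ≦ ((Lʲη)_c²)⁻¹` — conclusion unchanged (edition 30's `hD2sup` at `𝔯 := resYOfC2 N θ M⋆ 𝔠`).
[cite: Balaban1985BackgroundPropagators, (3.136)–(3.137) pp.422–423, (3.11) p.392, p.398; Balaban1985Averaging, (149) p.40; Balaban1984PropagatorsII, (2.51) p.232, (2.54), (2.60)–(2.61) pp.233–234] -/
theorem hD2sup_of_form_schemas_wRPQ_J (q : PinPrims) (hq : q.OK) (H : MemberY θ.d₆ θ.ℓ₆ θ.hd' θ.hL' θ.b₀ θ.b₁ Mstar → Prop) {J : Type} (f : J → MemberY θ.d₆ θ.ℓ₆ θ.hd' θ.hL' θ.b₀ θ.b₁ Mstar) (𝔠 : C2Y N θ Mstar)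
    (𝔮 : ∀ x : MemberY θ.d₆ θ.ℓ₆ θ.hd' θ.hL' θ.b₀ θ.b₁ Mstar, Node00.OpsYQLetter.QLetterY (Matrix (Fin N) (Fin N) ℂ) x.toKIdx)
    (𝔮s : ∀ x : MemberY θ.d₆ θ.ℓ₆ θ.hd' θ.hL' θ.b₀ θ.b₁ Mstar, Node00.OpsYQLetter.QsLetterY (Matrix (Fin N) (Fin N) ℂ) x.toKIdx)
    (parT : ∀ i : B6KLevelCensusIndexV1.KIdx θ.d₆ θ.ℓ₆ θ.hd' θ.hL' θ.b₀ θ.b₁, Node00.SiteParY (Matrix (Fin N) (Fin N) ℂ) i)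
    (R₁ R₂ : RegFamY θ.d₆ θ.ℓ₆ θ.hd' θ.hL' θ.b₀ θ.b₁ Mstar (Matrix (Fin N) (Fin N) ℂ)) (c : ℝ)
    (𝔬12 : ∀ x : MemberY θ.d₆ θ.ℓ₆ θ.hd' θ.hL' θ.b₀ θ.b₁ Mstar, B9Thm312Whole.Ops (geo9Y x) (bg9YR (Matrix (Fin N) (Fin N) ℂ) (specialUnitaryUnits (Fin N)) R₁ R₂ x)
      (XBK (TrIdx N) x.toKIdx) (XBK (TrIdx N) x.toKIdx) (XHK (TrIdx N) x.toKIdx) (XSK (TrIdx N) x.toKIdx))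
    (bI : ∀ x : MemberY θ.d₆ θ.ℓ₆ θ.hd' θ.hL' θ.b₀ θ.b₁ Mstar, FBondY x.toKIdx → IBondY x.toKIdx)
    (hblk12 : ∀ x : MemberY θ.d₆ θ.ℓ₆ θ.hd' θ.hL' θ.b₀ θ.b₁ Mstar, (𝔬12 x).blk = blkBK x.toKIdx (bI x))
    (wC wH : ∀ x : MemberY θ.d₆ θ.ℓ₆ θ.hd' θ.hL' θ.b₀ θ.b₁ Mstar, IBondY x.toKIdx → ℝ)
    (hwC : ∀ x c, 0 ≤ wC x c) (hwH : ∀ x c, 0 ≤ wH x c) (hww : ∀ x c, wC x c * wH x c ≤ ((geo9Y x).len c ^ 2)⁻¹)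
    (κC δC tHJ ρR δ₂ θ₂ M a : ℝ) (hκC : 0 ≤ κC) (htHJ : 0 ≤ tHJ) (hρR : 0 < ρR) (hδ₂ : 0 ≤ δ₂) (hM : 0 < M)
    (hδC : δ₂ + q.αF * ((1 - 2 * q.α) * q.δ₀) + ρR ≤ δC)
    (hθ₂ : (cR39 (trBasis N))⁻¹ * (2 * N * basisBound39 (trBasis N) ^ 2 * κC * tHJ * (((θ.ℓ₆ + 1 : ℕ) : ℝ) ^ 2) *
      rowConst261 (geo9Y (d := θ.d₆) (ℓ := θ.ℓ₆) (hd := θ.hd') (hL := θ.hL') (b₀ := θ.b₀) (b₁ := θ.b₁) (Mstar := Mstar)) ρR) ≤ θ₂)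
    (hC2 : ∀ x : MemberY θ.d₆ θ.ℓ₆ θ.hd' θ.hL' θ.b₀ θ.b₁ Mstar, M ≤ (geo9Y x).M → ∀ α₀ : ℝ, 0 < α₀ → (geo9Y x).M * α₀ ≤ a →
      ∀ U : (bg9YR (Matrix (Fin N) (Fin N) ℂ) (specialUnitaryUnits (Fin N)) R₁ R₂ x).Cfg,
        (bg9YR (Matrix (Fin N) (Fin N) ℂ) (specialUnitaryUnits (Fin N)) R₁ R₂ x).Reg335 c α₀ U →
        (bg9YR (Matrix (Fin N) (Fin N) ℂ) (specialUnitaryUnits (Fin N)) R₁ R₂ x).Reg336 c α₀ U →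
          C2FormMaj x.toKIdx (g := geo9Y x) (bI x) (fun c => c) (𝔠 x).form U κC δC (wC x))
    (hHJ : ∀ j : J, M ≤ (geo9Y (f j)).M → ∀ α₀ : ℝ, 0 < α₀ → (geo9Y (f j)).M * α₀ ≤ a →
      ∀ U : (bg9YR (Matrix (Fin N) (Fin N) ℂ) (specialUnitaryUnits (Fin N)) R₁ R₂ (f j)).Cfg,
        (bg9YR (Matrix (Fin N) (Fin N) ℂ) (specialUnitaryUnits (Fin N)) R₁ R₂ (f j)).Reg335 c α₀ U →
        (bg9YR (Matrix (Fin N) (Fin N) ℂ) (specialUnitaryUnits (Fin N)) R₁ R₂ (f j)).Reg336 c α₀ U →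
          ∀ c : IBondY (f j).toKIdx,
            ‖trAdjY (trDualMatY N) (HDQY (f j).toKIdx (𝔮 (f j)) (𝔮s (f j)) (parT (f j).toKIdx) (GpPhysY (f j).toKIdx (parT (f j).toKIdx)) U) (JY (f j).toKIdx U) c‖ ≤
              tHJ * ((geo9Y (f j)).M * α₀) * wH (f j) c) :
    ∃ ML : ℝ, ∀ j : J, ML ≤ (geo9Y (f j)).M → M ≤ (geo9Y (f j)).M → ∀ α₀ : ℝ, 0 < α₀ → (geo9Y (f j)).M * α₀ ≤ a →
      ∀ U : (bg9YR (Matrix (Fin N) (Fin N) ℂ) (specialUnitaryUnits (Fin N)) R₁ R₂ (f j)).Cfg,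
        (bg9YR (Matrix (Fin N) (Fin N) ℂ) (specialUnitaryUnits (Fin N)) R₁ R₂ (f j)).Reg335 c α₀ U →
        (bg9YR (Matrix (Fin N) (Fin N) ℂ) (specialUnitaryUnits (Fin N)) R₁ R₂ (f j)).Reg336 c α₀ U →
          HasMajorant (g := toB6 (geo9Y (f j)) 1 (H (f j))) (𝔬12 (f j)).blk
            (D2coK (f j).toKIdx (trBasis N) (bg9YR (Matrix (Fin N) (Fin N) ℂ) (specialUnitaryUnits (Fin N)) R₁ R₂ (f j)) (fun U => U) (delta2OfQY (trDualMatY N) (f j).toKIdx (𝔮 (f j)) (𝔮s (f j)) (parT (f j).toKIdx) (GpPhysY (f j).toKIdx (parT (f j).toKIdx)) (𝔠 (f j)).form) U)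
            (fun (a b : (geo9Y (f j)).Site) => θ₂ * ((geo9Y (f j)).M * α₀) * ((geo9Y (f j)).len a ^ 2)⁻¹ * Real.exp (-(δ₂ * (geo9Y (f j)).dist a b))) := by
  obtain ⟨Mth, -, hfacts, -⟩ :=
    lemma21Pack_geo9Y (d := θ.d₆) (ℓ := θ.ℓ₆) (hd := θ.hd') (hL := θ.hL') (b₀ := θ.b₀) (b₁ := θ.b₁) (Mstar := Mstar) H hq.α_pos hq.α_lt
      hq.δ₀_pos hq.αF_pos (by linarith only [hq.αF_lt])
  obtain ⟨MLσ, hrowc⟩ := rowConst261_spec_of_rowSum261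
    (rowSum261_geo9Y (d := θ.d₆) (ℓ := θ.ℓ₆) (hd := θ.hd') (hL := θ.hL') (b₀ := θ.b₀) (b₁ := θ.b₁) (Mstar := Mstar)) hρR
  have hN : 0 < N := Nat.pos_of_ne_zero (NeZero.ne N)
  have hc0 : 0 < cR39 (trBasis N) := cR39_trBasis_pos hN
  have hτ : 0 ≤ q.αF * ((1 - 2 * q.α) * q.δ₀) :=
    mul_nonneg hq.αF_pos.le (mul_nonneg (by linarith only [hq.α_lt]) hq.δ₀_pos.le)
  refine ⟨max Mth MLσ, fun j hMx hMM α₀ hα ha U hU hU' => ?_⟩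
  have hgeo : GeoOK (geo9Y (f j)) := ⟨geo9Y_dist_triangle (f j), geo9Y_dist_comm (f j), geo9K_dist_nonneg (f j).toKIdx, geo9Y_len_pos (f j)⟩
  have hF := hfacts (f j) ((le_max_left _ _).trans hMx)
  have hθ : 0 ≤ (geo9Y (f j)).M * α₀ := mul_nonneg (hM.le.trans hMM) hα.le
  -- p. 398 transfer for the net weight (Lʲη)⁻² ≥ w_C·w_H
  have hL1 : 1 ≤ (geo9Y (f j)).L := hF.one_le_L
  have hLle : (geo9Y (f j)).L ^ |(-2 : ℝ)| ≤ ((θ.ℓ₆ + 1 : ℕ) : ℝ) ^ 2 := by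
    rw [show |(-2 : ℝ)| = (2 : ℕ) by norm_num, Real.rpow_natCast]
    exact pow_le_pow_left₀ (zero_le_one.trans hL1) hF.L_le 2
  have hT : ∀ (y : (geo9Y (f j)).Site) (c : IBondY (f j).toKIdx),
      Real.exp (-(q.αF * ((1 - 2 * q.α) * q.δ₀) * (geo9Y (f j)).dist y c)) * (wC (f j) c * wH (f j) c) ≤
        ((θ.ℓ₆ + 1 : ℕ) : ℝ) ^ 2 * ((geo9Y (f j)).len y ^ 2)⁻¹ := by
    intro y c
    have hst := scaleTransfer_len_rpow hF (-2) (by norm_num) y c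
    have hc := geo9Y_len_pos (f j) c
    have hy := geo9Y_len_pos (f j) y
    have e1 : ((geo9Y (f j)).len c ^ 2)⁻¹ = (geo9Y (f j)).len c ^ (-2 : ℝ) := by
      rw [show (-2 : ℝ) = -((2 : ℕ) : ℝ) by norm_num, Real.rpow_neg hc.le, Real.rpow_natCast]
    have e2 : ((geo9Y (f j)).len y ^ 2)⁻¹ = (geo9Y (f j)).len y ^ (-2 : ℝ) := by
      rw [show (-2 : ℝ) = -((2 : ℕ) : ℝ) by norm_num, Real.rpow_neg hy.le, Real.rpow_natCast]
    calc Real.exp (-(q.αF * ((1 - 2 * q.α) * q.δ₀) * (geo9Y (f j)).dist y c)) * (wC (f j) c * wH (f j) c)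
        ≤ Real.exp (-(q.αF * ((1 - 2 * q.α) * q.δ₀) * (geo9Y (f j)).dist y c)) * (geo9Y (f j)).len c ^ (-2 : ℝ) := by
          rw [← e1]; exact mul_le_mul_of_nonneg_left (hww (f j) c) (Real.exp_nonneg _)
      _ ≤ ((θ.ℓ₆ + 1 : ℕ) : ℝ) ^ 2 * ((geo9Y (f j)).len y ^ 2)⁻¹ := by
          rw [e2]; exact hst.trans (mul_le_mul_of_nonneg_right hLle (Real.rpow_nonneg hy.le _))
  have hR : ∀ y : (geo9Y (f j)).Site, ∑ c : IBondY (f j).toKIdx, Real.exp (-(ρR * (geo9Y (f j)).dist y c)) ≤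
      rowConst261 (geo9Y (d := θ.d₆) (ℓ := θ.ℓ₆) (hd := θ.hd') (hL := θ.hL') (b₀ := θ.b₀) (b₁ := θ.b₁) (Mstar := Mstar)) ρR := by
    intro y
    have h := hrowc (f j) ((le_max_right _ _).trans hMx) y
    have huniv : (Finset.univ : Finset (IBondY (f j).toKIdx)) =
        @Finset.univ (geo9Y (f j)).Site (‹∀ x : MemberY θ.d₆ θ.ℓ₆ θ.hd' θ.hL' θ.b₀ θ.b₁ Mstar, Fintype (geo9Y x).Site› (f j)) := by
      ext c
      exact ⟨fun _ => @Finset.mem_univ (geo9Y (f j)).Site (‹∀ x : MemberY θ.d₆ θ.ℓ₆ θ.hd' θ.hL' θ.b₀ θ.b₁ Mstar, Fintype (geo9Y x).Site› (f j)) c,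
        fun _ => Finset.mem_univ c⟩
    rw [huniv]; exact h
  have hmain := hasMajorant_coordOpK_delta2OfHY (f j).toKIdx (HDQY (f j).toKIdx (𝔮 (f j)) (𝔮s (f j)) (parT (f j).toKIdx) (GpPhysY (f j).toKIdx (parT (f j).toKIdx))) (𝔠 (f j)).form
    (g := geo9Y (f j)) (R₀ := 1) (H₀ := H (f j)) hgeo (bI (f j)) (fun c => c) U
    (κC := κC) (δC := δC) (tHJ := tHJ * ((geo9Y (f j)).M * α₀)) (ρT := q.αF * ((1 - 2 * q.α) * q.δ₀)) (CT := ((θ.ℓ₆ + 1 : ℕ) : ℝ) ^ 2)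
    (ρR := ρR) (cR := rowConst261 (geo9Y (d := θ.d₆) (ℓ := θ.ℓ₆) (hd := θ.hd') (hL := θ.hL') (b₀ := θ.b₀) (b₁ := θ.b₁) (Mstar := Mstar)) ρR)
    (δ₂ := δ₂) (r := (cR39 (trBasis N))⁻¹) (wC := wC (f j)) (wH := wH (f j)) (W := fun y => ((geo9Y (f j)).len y ^ 2)⁻¹)
    hκC (hwC (f j)) (mul_nonneg htHJ hθ) (hwH (f j)) (by positivity)
    (fun y => inv_nonneg.mpr (pow_nonneg (geo9Y_len_pos (f j) y).le 2)) (inv_nonneg.mpr hc0.le) hδ₂ hτ hρR.le hδC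
    (hC2 (f j) hMM α₀ hα ha U hU hU') (hHJ j hMM α₀ hα ha U hU hU') hT hR
  rw [hblk12 (f j), Node00.delta2OfQY_eq]
  refine hasMajorant_mono _ hmain fun y y' => ?_
  exact kernel_dom hθ₂ hθ (inv_nonneg.mpr (pow_nonneg (geo9Y_len_pos (f j) y).le 2)) (Real.exp_nonneg _)

/-- ★★ (the SCALED `G′_phys` TWIN of `…N06HTransposeAtPinsPhysR.hHT_of_GD_C_lettersR`: `isTransposePair_HcoK_HDY_physY`, and `hasMajorantHom_CQG_of_letters_sq` carrying `G_D`'s `(Lʲη)_a²` to the coarse weight `W_C·(Lʲη)²`; free rates `ρG ∕ δCz ∕ ρT`, transfer `τT`, row sum `σT`) **F8′'s TRANSPOSE LETTER `hHT` AT THE EXPLICIT FAMILY `𝔗 := (C ∘ Q) ∘ G_D`, FROM THE `G_D` AND WEIGHTED-`C` SUP LETTERS** (module docstring): above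
ONE threshold and in the regime, (i) `IsTransposePair (HcoK … (HDY … GpY …) U) ((CcoK … U ∘ₗ QcoKH … U) ∘ₗ GcoK … (GDY …) U)` (a THEOREM at `SU(N)`-valued
`U`) and (ii) its [4]-(2.51) majorant `r_C·c₁·W_C(c)·(e^{δ₀(ℓ+4)}·c₁·1·r_G)·e^{−(1−α)δ₀ d(c,y′)}` from the fine carrier (blocks `bI x`) to the coarse one.
[cite: Balaban1985BackgroundPropagators, (3.126) p.420, (3.130) p.421, (3.132)–(3.133) p.422, (3.12)–(3.14) p.393, Thm 3.11 p.416; Balaban1984PropagatorsII, (2.51)–(2.56) pp.232–233, Lemma 2.1 (2.61) p.234] -/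
theorem hHT_of_GD_C_lettersRP_sq_q_J (H : MemberY θ.d₆ θ.ℓ₆ θ.hd' θ.hL' θ.b₀ θ.b₁ Mstar → Prop) {J : Type} (f : J → MemberY θ.d₆ θ.ℓ₆ θ.hd' θ.hL' θ.b₀ θ.b₁ Mstar)
    (R₁ R₂ : RegFamY θ.d₆ θ.ℓ₆ θ.hd' θ.hL' θ.b₀ θ.b₁ Mstar (Matrix (Fin N) (Fin N) ℂ)) (c : ℝ)
    (𝔮 : ∀ x : MemberY θ.d₆ θ.ℓ₆ θ.hd' θ.hL' θ.b₀ θ.b₁ Mstar, Node00.OpsYQLetter.QLetterY (Matrix (Fin N) (Fin N) ℂ) x.toKIdx)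
    (𝔮s : ∀ x : MemberY θ.d₆ θ.ℓ₆ θ.hd' θ.hL' θ.b₀ θ.b₁ Mstar, Node00.OpsYQLetter.QsLetterY (Matrix (Fin N) (Fin N) ℂ) x.toKIdx)
    (parT : ∀ i : B6KLevelCensusIndexV1.KIdx θ.d₆ θ.ℓ₆ θ.hd' θ.hL' θ.b₀ θ.b₁, Node00.SiteParY (Matrix (Fin N) (Fin N) ℂ) i)
    (bI : ∀ x : MemberY θ.d₆ θ.ℓ₆ θ.hd' θ.hL' θ.b₀ θ.b₁ Mstar, FBondY x.toKIdx → IBondY x.toKIdx)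
    (WC : ∀ x : MemberY θ.d₆ θ.ℓ₆ θ.hd' θ.hL' θ.b₀ θ.b₁ Mstar, IBondY x.toKIdx → ℝ) (hWC : ∀ x c, 0 ≤ WC x c)
    (rG ρG rC δCz σT τT ρT M a : ℝ) (hrG : 0 ≤ rG) (hrC : 0 ≤ rC) (hσT : 0 < σT) (hτT : 0 < τT) (hρT : 0 ≤ ρT) (hρTG : ρT ≤ ρG)
    (hρTC : ρT + σT + τT ≤ δCz)
    -- [P-D2-knit] the pair's adjointness, the symmetry of `G̃[𝔮](U)` and the (3.15) block law of `𝔮`, DISPLAYED on the carrier's regime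
    (hadj : ∀ (x : MemberY θ.d₆ θ.ℓ₆ θ.hd' θ.hL' θ.b₀ θ.b₁ Mstar) (α₀ : ℝ) (U : (bg9YR (Matrix (Fin N) (Fin N) ℂ) (specialUnitaryUnits (Fin N)) R₁ R₂ x).Cfg),
      (bg9YR (Matrix (Fin N) (Fin N) ℂ) (specialUnitaryUnits (Fin N)) R₁ R₂ x).Reg335 c α₀ U →
        IsAdjTr (fun _ => (1 : ℝ)) (fun _ => (1 : ℝ)) (𝔮 x U) (𝔮s x U))
    (hGD : ∀ x : MemberY θ.d₆ θ.ℓ₆ θ.hd' θ.hL' θ.b₀ θ.b₁ Mstar, M ≤ (geo9Y x).M → ∀ α₀ : ℝ, 0 < α₀ → (geo9Y x).M * α₀ ≤ a →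
      ∀ U : (bg9YR (Matrix (Fin N) (Fin N) ℂ) (specialUnitaryUnits (Fin N)) R₁ R₂ x).Cfg,
        (bg9YR (Matrix (Fin N) (Fin N) ℂ) (specialUnitaryUnits (Fin N)) R₁ R₂ x).Reg335 c α₀ U →
        (bg9YR (Matrix (Fin N) (Fin N) ℂ) (specialUnitaryUnits (Fin N)) R₁ R₂ x).Reg336 c α₀ U →
          IsSymmTr (fun _ => (1 : ℝ)) (GDQY x.toKIdx (𝔮 x) (𝔮s x) (parT x.toKIdx) (GpPhysY x.toKIdx (parT x.toKIdx)) U))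
    (BQ : ℝ) (hBQ : 0 ≤ BQ)
    (hQ15 : ∀ x : MemberY θ.d₆ θ.ℓ₆ θ.hd' θ.hL' θ.b₀ θ.b₁ Mstar, M ≤ (geo9Y x).M → ∀ α₀ : ℝ, 0 < α₀ → (geo9Y x).M * α₀ ≤ a →
      ∀ U : (bg9YR (Matrix (Fin N) (Fin N) ℂ) (specialUnitaryUnits (Fin N)) R₁ R₂ x).Cfg,
        (bg9YR (Matrix (Fin N) (Fin N) ℂ) (specialUnitaryUnits (Fin N)) R₁ R₂ x).Reg335 c α₀ U →
        (bg9YR (Matrix (Fin N) (Fin N) ℂ) (specialUnitaryUnits (Fin N)) R₁ R₂ x).Reg336 c α₀ U →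
          ∀ δ : ℝ, 0 ≤ δ → HasMajorantHom (g := toB6 (geo9Y x) 1 (H x)) (blkBK x.toKIdx (bI x)) (blkHK x.toKIdx)
            (QcoKHq x.toKIdx (trBasis N) (bg9YR (Matrix (Fin N) (Fin N) ℂ) (specialUnitaryUnits (Fin N)) R₁ R₂ x) (fun U => U) (𝔮 x) U)
            (fun a a' => BQ * Real.exp (δ * ((θ.ℓ₆ : ℝ) + 4)) * Real.exp (-(δ * (geo9Y x).dist a a'))))
    (hGDsup : ∀ j : J, M ≤ (geo9Y (f j)).M → ∀ α₀ : ℝ, 0 < α₀ → (geo9Y (f j)).M * α₀ ≤ a →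
      ∀ U : (bg9YR (Matrix (Fin N) (Fin N) ℂ) (specialUnitaryUnits (Fin N)) R₁ R₂ (f j)).Cfg,
        (bg9YR (Matrix (Fin N) (Fin N) ℂ) (specialUnitaryUnits (Fin N)) R₁ R₂ (f j)).Reg335 c α₀ U →
        (bg9YR (Matrix (Fin N) (Fin N) ℂ) (specialUnitaryUnits (Fin N)) R₁ R₂ (f j)).Reg336 c α₀ U →
          HasMajorant (g := toB6 (geo9Y (f j)) 1 (H (f j))) (blkBK (f j).toKIdx (bI (f j)))
            (GcoK (f j).toKIdx (trBasis N) (bg9YR (Matrix (Fin N) (Fin N) ℂ) (specialUnitaryUnits (Fin N)) R₁ R₂ (f j)) (fun U => U)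
              (GDQY (f j).toKIdx (𝔮 (f j)) (𝔮s (f j)) (parT (f j).toKIdx) (GpPhysY (f j).toKIdx (parT (f j).toKIdx))) U)
            (fun a b => rG * (geo9Y (f j)).len a ^ 2 * Real.exp (-(ρG * (geo9Y (f j)).dist a b))))
    (hCsup : ∀ j : J, M ≤ (geo9Y (f j)).M → ∀ α₀ : ℝ, 0 < α₀ → (geo9Y (f j)).M * α₀ ≤ a →
      ∀ U : (bg9YR (Matrix (Fin N) (Fin N) ℂ) (specialUnitaryUnits (Fin N)) R₁ R₂ (f j)).Cfg,
        (bg9YR (Matrix (Fin N) (Fin N) ℂ) (specialUnitaryUnits (Fin N)) R₁ R₂ (f j)).Reg335 c α₀ U →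
        (bg9YR (Matrix (Fin N) (Fin N) ℂ) (specialUnitaryUnits (Fin N)) R₁ R₂ (f j)).Reg336 c α₀ U →
          HasMajorant (g := toB6 (geo9Y (f j)) 1 (H (f j))) (blkHK (f j).toKIdx)
            (CcoKq (f j).toKIdx (trBasis N) (bg9YR (Matrix (Fin N) (Fin N) ℂ) (specialUnitaryUnits (Fin N)) R₁ R₂ (f j)) (fun U => U)
              (𝔮 (f j)) (𝔮s (f j)) (parT (f j).toKIdx) (GpPhysY (f j).toKIdx (parT (f j).toKIdx)) U)
            (fun a b => rC * WC (f j) a * Real.exp (-(δCz * (geo9Y (f j)).dist a b)))) :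
    ∃ MT : ℝ, ∀ j : J, MT ≤ (geo9Y (f j)).M → M ≤ (geo9Y (f j)).M → ∀ α₀ : ℝ, 0 < α₀ → (geo9Y (f j)).M * α₀ ≤ a →
      ∀ U : (bg9YR (Matrix (Fin N) (Fin N) ℂ) (specialUnitaryUnits (Fin N)) R₁ R₂ (f j)).Cfg,
        (bg9YR (Matrix (Fin N) (Fin N) ℂ) (specialUnitaryUnits (Fin N)) R₁ R₂ (f j)).Reg335 c α₀ U →
        (bg9YR (Matrix (Fin N) (Fin N) ℂ) (specialUnitaryUnits (Fin N)) R₁ R₂ (f j)).Reg336 c α₀ U →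
          IsTransposePair (HcoK (f j).toKIdx (trBasis N) (bg9YR (Matrix (Fin N) (Fin N) ℂ) (specialUnitaryUnits (Fin N)) R₁ R₂ (f j)) (fun U => U)
              (HDQY (f j).toKIdx (𝔮 (f j)) (𝔮s (f j)) (parT (f j).toKIdx) (GpPhysY (f j).toKIdx (parT (f j).toKIdx))) U)
            ((CcoKq (f j).toKIdx (trBasis N) (bg9YR (Matrix (Fin N) (Fin N) ℂ) (specialUnitaryUnits (Fin N)) R₁ R₂ (f j)) (fun U => U)
                (𝔮 (f j)) (𝔮s (f j)) (parT (f j).toKIdx) (GpPhysY (f j).toKIdx (parT (f j).toKIdx)) U ∘ₗ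
              QcoKHq (f j).toKIdx (trBasis N) (bg9YR (Matrix (Fin N) (Fin N) ℂ) (specialUnitaryUnits (Fin N)) R₁ R₂ (f j)) (fun U => U) (𝔮 (f j)) U) ∘ₗ
              GcoK (f j).toKIdx (trBasis N) (bg9YR (Matrix (Fin N) (Fin N) ℂ) (specialUnitaryUnits (Fin N)) R₁ R₂ (f j)) (fun U => U)
                (GDQY (f j).toKIdx (𝔮 (f j)) (𝔮s (f j)) (parT (f j).toKIdx) (GpPhysY (f j).toKIdx (parT (f j).toKIdx))) U) ∧
            HasMajorantHom (g := toB6 (geo9Y (f j)) 1 (H (f j))) (fun p : XBK (TrIdx N) (f j).toKIdx => bI (f j) p.1) (fun p : XHK (TrIdx N) (f j).toKIdx => p.1)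
              ((CcoKq (f j).toKIdx (trBasis N) (bg9YR (Matrix (Fin N) (Fin N) ℂ) (specialUnitaryUnits (Fin N)) R₁ R₂ (f j)) (fun U => U)
                  (𝔮 (f j)) (𝔮s (f j)) (parT (f j).toKIdx) (GpPhysY (f j).toKIdx (parT (f j).toKIdx)) U ∘ₗ
                QcoKHq (f j).toKIdx (trBasis N) (bg9YR (Matrix (Fin N) (Fin N) ℂ) (specialUnitaryUnits (Fin N)) R₁ R₂ (f j)) (fun U => U) (𝔮 (f j)) U) ∘ₗ
                GcoK (f j).toKIdx (trBasis N) (bg9YR (Matrix (Fin N) (Fin N) ℂ) (specialUnitaryUnits (Fin N)) R₁ R₂ (f j)) (fun U => U)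
                  (GDQY (f j).toKIdx (𝔮 (f j)) (𝔮s (f j)) (parT (f j).toKIdx) (GpPhysY (f j).toKIdx (parT (f j).toKIdx))) U)
              (fun c y' => (rC * ((BQ * Real.exp ((ρG + σT + 1 / 2 * (2 * τT)) * ((θ.ℓ₆ : ℝ) + 4))) * rG * (((θ.ℓ₆ + 1 : ℕ) : ℝ)) ^ 2 * rowConst261 (geo9Y (d := θ.d₆) (ℓ := θ.ℓ₆) (hd := θ.hd') (hL := θ.hL') (b₀ := θ.b₀) (b₁ := θ.b₁) (Mstar := Mstar)) σT) * (((θ.ℓ₆ + 1 : ℕ) : ℝ)) ^ 2 * rowConst261 (geo9Y (d := θ.d₆) (ℓ := θ.ℓ₆) (hd := θ.hd') (hL := θ.hL') (b₀ := θ.b₀) (b₁ := θ.b₁) (Mstar := Mstar)) σT) *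
                (WC (f j) c * (geo9Y (f j)).len c ^ 2) * Real.exp (-(ρT * (geo9Y (f j)).dist c y'))) := by
  obtain ⟨Mg, hFa⟩ := facts347_exp261_geo9Y (d := θ.d₆) (ℓ := θ.ℓ₆) (hd := θ.hd') (hL := θ.hL') (b₀ := θ.b₀) (b₁ := θ.b₁) (Mstar := Mstar) H (α := 1 / 2) (δ := 2 * τT)
    (by norm_num) (by norm_num) (by linarith)
  obtain ⟨ML, hrow⟩ := rowConst261_spec_of_rowSum261
    (rowSum261_geo9Y (d := θ.d₆) (ℓ := θ.ℓ₆) (hd := θ.hd') (hL := θ.hL') (b₀ := θ.b₀) (b₁ := θ.b₁) (Mstar := Mstar)) hσT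
  have hN : 0 < N := Nat.pos_of_ne_zero (NeZero.ne N)
  have hcR : 0 ≤ rowConst261 (geo9Y (d := θ.d₆) (ℓ := θ.ℓ₆) (hd := θ.hd') (hL := θ.hL') (b₀ := θ.b₀) (b₁ := θ.b₁) (Mstar := Mstar)) σT := rowConst261_nonneg _ _
  refine ⟨max Mg ML, fun j hMx hMM α₀ hα ha U hU hU' => ?_⟩
  refine ⟨isTransposePair_HcoK_HDQY (f j).toKIdx (bg9YR (Matrix (Fin N) (Fin N) ℂ) (specialUnitaryUnits (Fin N)) R₁ R₂ (f j)) (fun U => U)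
    (𝔮 (f j)) (𝔮s (f j)) (parT (f j).toKIdx) (GpPhysY (f j).toKIdx (parT (f j).toKIdx)) hN U (hadj (f j) α₀ U hU) (hGD (f j) hMM α₀ hα ha U hU hU'), ?_⟩
  letI : Fintype (geo9K (f j).toKIdx).Site := (inferInstance : Fintype (geo9Y (f j)).Site)
  have hGK : GeoOK (geo9K (f j).toKIdx) := ⟨geo9Y_dist_triangle (f j), geo9Y_dist_comm (f j), geo9K_dist_nonneg (f j).toKIdx, geo9Y_len_pos (f j)⟩
  have hrowx : RowSum (toB6 (geo9K (f j).toKIdx) 1 (H (f j))) σT (rowConst261 (geo9Y (d := θ.d₆) (ℓ := θ.ℓ₆) (hd := θ.hd') (hL := θ.hL') (b₀ := θ.b₀) (b₁ := θ.b₁) (Mstar := Mstar)) σT) := fun y => hrow (f j) ((le_max_right _ _).trans hMx) y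
  have h := hasMajorantHom_CQG_of_letters_sq_q (R₀ := 1) (H₀ := H (f j)) (f j).toKIdx (bg9YR (Matrix (Fin N) (Fin N) ℂ) (specialUnitaryUnits (Fin N)) R₁ R₂ (f j)) (fun U => U)
    U (𝔮 (f j)) hBQ (hQ15 (f j) hMM α₀ hα ha U hU hU') hGK (hFa (f j) ((le_max_left _ _).trans hMx))
    hrowx hcR hσT.le (by linarith) hρT hρTG (by linarith) hrG hrC (hWC (f j))
    (hGDsup j hMM α₀ hα ha U hU hU') (hCsup j hMM α₀ hα ha U hU hU')
  refine B6RandomWalkHom.hasMajorantHom_mono _ _ h fun a b => le_of_eq ?_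
  have hd : (geo9Y (f j)).dist a b = (geo9K (f j).toKIdx).dist a b := rfl
  have hl : (geo9Y (f j)).len a = (geo9K (f j).toKIdx).len a := rfl
  rw [hd, hl]

/-- ★★★ (the SCALED `G′_phys` TWIN of `…N06HTransposeAtPinsPhysR.hD2sup_of_GD_C_lettersR`: `G_D`'s letter with print's `(Lʲη)_a²`, free rates, the `(H\*J)` step through dag-n08-d's generic-letter wrapper at the coarse weight `W_C·(Lʲη)²`) **THE CERTIFICATE's `hD2sup` AT def-Y's `G′_phys`-FED RESIDUAL `delta2OfY … GpPhysY … (𝔠 x).form` (= `resYOfC2P … 𝔠`) FROM `hC2 + hreg + hGDsup + hCsup`** (F6 `hD2sup_of_form_schemas_w` ∘ F8′ (`…N06HstarJAtPinsWPhys`) ∘ `hHT_of_GD_C_letters`):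
the `(H\*J)` letter `hHJ` AND the transpose letter `hHT` ELIMINATED; what stays displayed on this road is [5] (149) (`hC2`, weight `w_C` with
`w_C·W_C·(Lʲη)⁻³ ≦ (Lʲη)⁻²`), the cube covering (`hreg`), Thm 3.12's `G_D` sup letter (`hGDsup`) and the weighted (3.132) letter (`hCsup`).  (Edition 29's
`hD2L2` follows the same way through F8′ (`…N06HstarJAtPinsWPhys`)'s `hD2L2_of_transpose_schemas_w` with def-Y's reality letters `hC hH`.)
[cite: Balaban1985BackgroundPropagators, (3.136)–(3.137) pp.422–423, (3.134) p.422, (3.126) p.420, (3.130) p.421, (3.132)–(3.133) p.422, (3.36) p.396, p.398; Balaban1985Averaging, (149) p.40; Balaban1984PropagatorsII, (2.51) p.232, (2.54), (2.60)–(2.61) pp.233–234] -/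
theorem hD2sup_of_GD_C_lettersRP_sq_q_J (q : PinPrims) (hq : q.OK) (H : MemberY θ.d₆ θ.ℓ₆ θ.hd' θ.hL' θ.b₀ θ.b₁ Mstar → Prop) {J : Type} (f : J → MemberY θ.d₆ θ.ℓ₆ θ.hd' θ.hL' θ.b₀ θ.b₁ Mstar) (𝔠 : C2Y N θ Mstar)
    (R₁ R₂ : RegFamY θ.d₆ θ.ℓ₆ θ.hd' θ.hL' θ.b₀ θ.b₁ Mstar (Matrix (Fin N) (Fin N) ℂ)) (c : ℝ)
    (𝔮 : ∀ x : MemberY θ.d₆ θ.ℓ₆ θ.hd' θ.hL' θ.b₀ θ.b₁ Mstar, Node00.OpsYQLetter.QLetterY (Matrix (Fin N) (Fin N) ℂ) x.toKIdx)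
    (𝔮s : ∀ x : MemberY θ.d₆ θ.ℓ₆ θ.hd' θ.hL' θ.b₀ θ.b₁ Mstar, Node00.OpsYQLetter.QsLetterY (Matrix (Fin N) (Fin N) ℂ) x.toKIdx)
    (parT : ∀ i : B6KLevelCensusIndexV1.KIdx θ.d₆ θ.ℓ₆ θ.hd' θ.hL' θ.b₀ θ.b₁, Node00.SiteParY (Matrix (Fin N) (Fin N) ℂ) i)
    (𝔬12 : ∀ x : MemberY θ.d₆ θ.ℓ₆ θ.hd' θ.hL' θ.b₀ θ.b₁ Mstar, B9Thm312Whole.Ops (geo9Y x) (bg9YR (Matrix (Fin N) (Fin N) ℂ) (specialUnitaryUnits (Fin N)) R₁ R₂ x)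
      (XBK (TrIdx N) x.toKIdx) (XBK (TrIdx N) x.toKIdx) (XHK (TrIdx N) x.toKIdx) (B9CoReadingCoordsS.XSK (TrIdx N) x.toKIdx))
    (bI : ∀ x : MemberY θ.d₆ θ.ℓ₆ θ.hd' θ.hL' θ.b₀ θ.b₁ Mstar, FBondY x.toKIdx → IBondY x.toKIdx)
    (hbI0 : ∀ (x : MemberY θ.d₆ θ.ℓ₆ θ.hd' θ.hL' θ.b₀ θ.b₁ Mstar) (f : FBondY x.toKIdx), bI x f = bI x ⟨f.src, 0⟩)
    (hblk12 : ∀ x : MemberY θ.d₆ θ.ℓ₆ θ.hd' θ.hL' θ.b₀ θ.b₁ Mstar, (𝔬12 x).blk = blkBK x.toKIdx (bI x))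
    (wC WC : ∀ x : MemberY θ.d₆ θ.ℓ₆ θ.hd' θ.hL' θ.b₀ θ.b₁ Mstar, IBondY x.toKIdx → ℝ) (hwC : ∀ x c, 0 ≤ wC x c) (hWC : ∀ x c, 0 ≤ WC x c)
    (hww : ∀ x c, wC x c * ((WC x c * (geo9Y x).len c ^ 2) * ((geo9Y x).len c ^ 3)⁻¹) ≤ ((geo9Y x).len c ^ 2)⁻¹)
    (κC δC rG ρG rC δCz σT τT ρT cJ ρR tHJ δ₂ θ₂ M a : ℝ) (hκC : 0 ≤ κC) (hrG : 0 ≤ rG) (hrC : 0 ≤ rC) (hσT : 0 < σT) (hτT : 0 < τT) (hρT : 0 ≤ ρT)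
    (hρTG : ρT ≤ ρG) (hρTC : ρT + σT + τT ≤ δCz) (hcJ : 0 ≤ cJ) (hρR : 0 < ρR) (hδ₂ : 0 ≤ δ₂) (hM : 0 < M)
    (ha1 : cJ * a ≤ 1) (hδC : δ₂ + q.αF * ((1 - 2 * q.α) * q.δ₀) + ρR ≤ δC) (hρ : q.αF * ((1 - 2 * q.α) * q.δ₀) + ρR ≤ ρT)
    -- [P-D2-knit] the pair's adjointness, the symmetry of `G̃[𝔮](U)` and the (3.15) block law of `𝔮`, DISPLAYED on the carrier's regime
    (hadj : ∀ (x : MemberY θ.d₆ θ.ℓ₆ θ.hd' θ.hL' θ.b₀ θ.b₁ Mstar) (α₀ : ℝ) (U : (bg9YR (Matrix (Fin N) (Fin N) ℂ) (specialUnitaryUnits (Fin N)) R₁ R₂ x).Cfg),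
      (bg9YR (Matrix (Fin N) (Fin N) ℂ) (specialUnitaryUnits (Fin N)) R₁ R₂ x).Reg335 c α₀ U →
        IsAdjTr (fun _ => (1 : ℝ)) (fun _ => (1 : ℝ)) (𝔮 x U) (𝔮s x U))
    (hGD : ∀ x : MemberY θ.d₆ θ.ℓ₆ θ.hd' θ.hL' θ.b₀ θ.b₁ Mstar, M ≤ (geo9Y x).M → ∀ α₀ : ℝ, 0 < α₀ → (geo9Y x).M * α₀ ≤ a →
      ∀ U : (bg9YR (Matrix (Fin N) (Fin N) ℂ) (specialUnitaryUnits (Fin N)) R₁ R₂ x).Cfg,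
        (bg9YR (Matrix (Fin N) (Fin N) ℂ) (specialUnitaryUnits (Fin N)) R₁ R₂ x).Reg335 c α₀ U →
        (bg9YR (Matrix (Fin N) (Fin N) ℂ) (specialUnitaryUnits (Fin N)) R₁ R₂ x).Reg336 c α₀ U →
          IsSymmTr (fun _ => (1 : ℝ)) (GDQY x.toKIdx (𝔮 x) (𝔮s x) (parT x.toKIdx) (GpPhysY x.toKIdx (parT x.toKIdx)) U))
    (BQ : ℝ) (hBQ : 0 ≤ BQ)
    (hQ15 : ∀ x : MemberY θ.d₆ θ.ℓ₆ θ.hd' θ.hL' θ.b₀ θ.b₁ Mstar, M ≤ (geo9Y x).M → ∀ α₀ : ℝ, 0 < α₀ → (geo9Y x).M * α₀ ≤ a →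
      ∀ U : (bg9YR (Matrix (Fin N) (Fin N) ℂ) (specialUnitaryUnits (Fin N)) R₁ R₂ x).Cfg,
        (bg9YR (Matrix (Fin N) (Fin N) ℂ) (specialUnitaryUnits (Fin N)) R₁ R₂ x).Reg335 c α₀ U →
        (bg9YR (Matrix (Fin N) (Fin N) ℂ) (specialUnitaryUnits (Fin N)) R₁ R₂ x).Reg336 c α₀ U →
          ∀ δ : ℝ, 0 ≤ δ → HasMajorantHom (g := toB6 (geo9Y x) 1 (H x)) (blkBK x.toKIdx (bI x)) (blkHK x.toKIdx)
            (QcoKHq x.toKIdx (trBasis N) (bg9YR (Matrix (Fin N) (Fin N) ℂ) (specialUnitaryUnits (Fin N)) R₁ R₂ x) (fun U => U) (𝔮 x) U)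
            (fun a a' => BQ * Real.exp (δ * ((θ.ℓ₆ : ℝ) + 4)) * Real.exp (-(δ * (geo9Y x).dist a a'))))
    (htHJ : N * basisBound39 (trBasis N) ^ 2 * (10 ^ 4 * ((θ.d₆ : ℝ) + 1) * cJ) *
      (((θ.d₆ : ℝ) + 1) * Fintype.card (TrIdx N) *
        (rC * ((BQ * Real.exp ((ρG + σT + 1 / 2 * (2 * τT)) * ((θ.ℓ₆ : ℝ) + 4))) * rG * (((θ.ℓ₆ + 1 : ℕ) : ℝ)) ^ 2 * rowConst261 (geo9Y (d := θ.d₆) (ℓ := θ.ℓ₆) (hd := θ.hd') (hL := θ.hL') (b₀ := θ.b₀) (b₁ := θ.b₁) (Mstar := Mstar)) σT) * (((θ.ℓ₆ + 1 : ℕ) : ℝ)) ^ 2 * rowConst261 (geo9Y (d := θ.d₆) (ℓ := θ.ℓ₆) (hd := θ.hd') (hL := θ.hL') (b₀ := θ.b₀) (b₁ := θ.b₁) (Mstar := Mstar)) σT)) *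
      ((((θ.ℓ₆ + 1 : ℕ) : ℝ) ^ 3) * rowConst261 (geo9Y (d := θ.d₆) (ℓ := θ.ℓ₆) (hd := θ.hd') (hL := θ.hL') (b₀ := θ.b₀) (b₁ := θ.b₁) (Mstar := Mstar)) ρR) ≤ tHJ)
    (hθ₂ : (B9Thm39ReadingCoords.cR39 (trBasis N))⁻¹ * (2 * N * basisBound39 (trBasis N) ^ 2 * κC * tHJ * (((θ.ℓ₆ + 1 : ℕ) : ℝ) ^ 2) *
      rowConst261 (geo9Y (d := θ.d₆) (ℓ := θ.ℓ₆) (hd := θ.hd') (hL := θ.hL') (b₀ := θ.b₀) (b₁ := θ.b₁) (Mstar := Mstar)) ρR) ≤ θ₂)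
    (hC2 : ∀ x : MemberY θ.d₆ θ.ℓ₆ θ.hd' θ.hL' θ.b₀ θ.b₁ Mstar, M ≤ (geo9Y x).M → ∀ α₀ : ℝ, 0 < α₀ → (geo9Y x).M * α₀ ≤ a →
      ∀ U : (bg9YR (Matrix (Fin N) (Fin N) ℂ) (specialUnitaryUnits (Fin N)) R₁ R₂ x).Cfg,
        (bg9YR (Matrix (Fin N) (Fin N) ℂ) (specialUnitaryUnits (Fin N)) R₁ R₂ x).Reg335 c α₀ U →
        (bg9YR (Matrix (Fin N) (Fin N) ℂ) (specialUnitaryUnits (Fin N)) R₁ R₂ x).Reg336 c α₀ U →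
          B9Delta2FormMajorant.C2FormMaj x.toKIdx (g := geo9Y x) (bI x) (fun c => c) (𝔠 x).form U κC δC (wC x))
    (hGDsup : ∀ j : J, M ≤ (geo9Y (f j)).M → ∀ α₀ : ℝ, 0 < α₀ → (geo9Y (f j)).M * α₀ ≤ a →
      ∀ U : (bg9YR (Matrix (Fin N) (Fin N) ℂ) (specialUnitaryUnits (Fin N)) R₁ R₂ (f j)).Cfg,
        (bg9YR (Matrix (Fin N) (Fin N) ℂ) (specialUnitaryUnits (Fin N)) R₁ R₂ (f j)).Reg335 c α₀ U →
        (bg9YR (Matrix (Fin N) (Fin N) ℂ) (specialUnitaryUnits (Fin N)) R₁ R₂ (f j)).Reg336 c α₀ U →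
          HasMajorant (g := toB6 (geo9Y (f j)) 1 (H (f j))) (blkBK (f j).toKIdx (bI (f j)))
            (GcoK (f j).toKIdx (trBasis N) (bg9YR (Matrix (Fin N) (Fin N) ℂ) (specialUnitaryUnits (Fin N)) R₁ R₂ (f j)) (fun U => U)
              (GDQY (f j).toKIdx (𝔮 (f j)) (𝔮s (f j)) (parT (f j).toKIdx) (GpPhysY (f j).toKIdx (parT (f j).toKIdx))) U)
            (fun a b => rG * (geo9Y (f j)).len a ^ 2 * Real.exp (-(ρG * (geo9Y (f j)).dist a b))))
    (hCsup : ∀ j : J, M ≤ (geo9Y (f j)).M → ∀ α₀ : ℝ, 0 < α₀ → (geo9Y (f j)).M * α₀ ≤ a →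
      ∀ U : (bg9YR (Matrix (Fin N) (Fin N) ℂ) (specialUnitaryUnits (Fin N)) R₁ R₂ (f j)).Cfg,
        (bg9YR (Matrix (Fin N) (Fin N) ℂ) (specialUnitaryUnits (Fin N)) R₁ R₂ (f j)).Reg335 c α₀ U →
        (bg9YR (Matrix (Fin N) (Fin N) ℂ) (specialUnitaryUnits (Fin N)) R₁ R₂ (f j)).Reg336 c α₀ U →
          HasMajorant (g := toB6 (geo9Y (f j)) 1 (H (f j))) (blkHK (f j).toKIdx)
            (CcoKq (f j).toKIdx (trBasis N) (bg9YR (Matrix (Fin N) (Fin N) ℂ) (specialUnitaryUnits (Fin N)) R₁ R₂ (f j)) (fun U => U)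
              (𝔮 (f j)) (𝔮s (f j)) (parT (f j).toKIdx) (GpPhysY (f j).toKIdx (parT (f j).toKIdx)) U)
            (fun a b => rC * WC (f j) a * Real.exp (-(δCz * (geo9Y (f j)).dist a b))))
    (hreg : ∀ x : MemberY θ.d₆ θ.ℓ₆ θ.hd' θ.hL' θ.b₀ θ.b₁ Mstar, M ≤ (geo9Y x).M → ∀ α₀ : ℝ, 0 < α₀ → (geo9Y x).M * α₀ ≤ a →
      ∀ U : (bg9YR (Matrix (Fin N) (Fin N) ℂ) (specialUnitaryUnits (Fin N)) R₁ R₂ x).Cfg,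
        (bg9YR (Matrix (Fin N) (Fin N) ℂ) (specialUnitaryUnits (Fin N)) R₁ R₂ x).Reg335 c α₀ U →
        (bg9YR (Matrix (Fin N) (Fin N) ℂ) (specialUnitaryUnits (Fin N)) R₁ R₂ x).Reg336 c α₀ U →
          ∀ μ s, RegularAt (shiftsV1 (PV θ.d₆ θ.ℓ₆ x.toKIdx.m x.toKIdx.K θ.hd' θ.hL')) U (etaBY x.toKIdx)
            (cJ * ((geo9Y x).M * α₀)) ((geo9Y x).len (bI x ⟨s, 0⟩)) μ s) :
    ∃ ML : ℝ, ∀ j : J, ML ≤ (geo9Y (f j)).M → M ≤ (geo9Y (f j)).M → ∀ α₀ : ℝ, 0 < α₀ → (geo9Y (f j)).M * α₀ ≤ a →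
      ∀ U : (bg9YR (Matrix (Fin N) (Fin N) ℂ) (specialUnitaryUnits (Fin N)) R₁ R₂ (f j)).Cfg,
        (bg9YR (Matrix (Fin N) (Fin N) ℂ) (specialUnitaryUnits (Fin N)) R₁ R₂ (f j)).Reg335 c α₀ U →
        (bg9YR (Matrix (Fin N) (Fin N) ℂ) (specialUnitaryUnits (Fin N)) R₁ R₂ (f j)).Reg336 c α₀ U →
          HasMajorant (g := toB6 (geo9Y (f j)) 1 (H (f j))) (𝔬12 (f j)).blk
            (B9PerturbationL2Delta2.D2coK (f j).toKIdx (trBasis N) (bg9YR (Matrix (Fin N) (Fin N) ℂ) (specialUnitaryUnits (Fin N)) R₁ R₂ (f j)) (fun U => U)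
              (delta2OfQY (trDualMatY N) (f j).toKIdx (𝔮 (f j)) (𝔮s (f j)) (parT (f j).toKIdx) (GpPhysY (f j).toKIdx (parT (f j).toKIdx)) (𝔠 (f j)).form) U)
            (fun (a b : (geo9Y (f j)).Site) => θ₂ * ((geo9Y (f j)).M * α₀) * ((geo9Y (f j)).len a ^ 2)⁻¹ * Real.exp (-(δ₂ * (geo9Y (f j)).dist a b))) := by
  obtain ⟨MT, hHT⟩ := hHT_of_GD_C_lettersRP_sq_q_J H f R₁ R₂ c 𝔮 𝔮s parT bI WC hWC rG ρG rC δCz σT τT ρT M a hrG hrC hσT hτT hρT hρTG hρTC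
    hadj hGD BQ hBQ hQ15 hGDsup hCsup
  have hM' : 0 < max M MT := lt_max_of_lt_left hM
  have hBT : 0 ≤ (rC * ((BQ * Real.exp ((ρG + σT + 1 / 2 * (2 * τT)) * ((θ.ℓ₆ : ℝ) + 4))) * rG * (((θ.ℓ₆ + 1 : ℕ) : ℝ)) ^ 2 * rowConst261 (geo9Y (d := θ.d₆) (ℓ := θ.ℓ₆) (hd := θ.hd') (hL := θ.hL') (b₀ := θ.b₀) (b₁ := θ.b₁) (Mstar := Mstar)) σT) * (((θ.ℓ₆ + 1 : ℕ) : ℝ)) ^ 2 * rowConst261 (geo9Y (d := θ.d₆) (ℓ := θ.ℓ₆) (hd := θ.hd') (hL := θ.hL') (b₀ := θ.b₀) (b₁ := θ.b₁) (Mstar := Mstar)) σT) := by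
    have h2 := rowConst261_nonneg (geo9Y (d := θ.d₆) (ℓ := θ.ℓ₆) (hd := θ.hd') (hL := θ.hL') (b₀ := θ.b₀) (b₁ := θ.b₁) (Mstar := Mstar)) σT
    positivity
  -- the `(H*J)` letter for `H = HDY … GpPhysY …` by dag-n08-d's generic-letter edition of F8′ (`B9Eq3136HstarJAtPinsLetterFamily`), coarse weight `W_C·(Lʲη)²`
  obtain ⟨MH, hHJ⟩ := B9Eq3136HstarJAtPinsLetterFamilyPt.norm_trAdjY_JY_le_of_transpose_schemas_wR_pt q hq H
    (fun x U => HDQY x.toKIdx (𝔮 x) (𝔮s x) (parT x.toKIdx) (GpPhysY x.toKIdx (parT x.toKIdx)) U) bI hbI0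
    (fun x U => (CcoKq x.toKIdx (trBasis N) (bg9YR (Matrix (Fin N) (Fin N) ℂ) (specialUnitaryUnits (Fin N)) R₁ R₂ x) (fun U => U)
        (𝔮 x) (𝔮s x) (parT x.toKIdx) (GpPhysY x.toKIdx (parT x.toKIdx)) U ∘ₗ
      QcoKHq x.toKIdx (trBasis N) (bg9YR (Matrix (Fin N) (Fin N) ℂ) (specialUnitaryUnits (Fin N)) R₁ R₂ x) (fun U => U) (𝔮 x) U) ∘ₗ
      GcoK x.toKIdx (trBasis N) (bg9YR (Matrix (Fin N) (Fin N) ℂ) (specialUnitaryUnits (Fin N)) R₁ R₂ x) (fun U => U)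
        (GDQY x.toKIdx (𝔮 x) (𝔮s x) (parT x.toKIdx) (GpPhysY x.toKIdx (parT x.toKIdx))) U)
    (fun x c => WC x c * (geo9Y x).len c ^ 2) (fun x c => mul_nonneg (hWC x c) (pow_nonneg (geo9Y_len_pos x c).le 2))
    cJ _ ρT ρR tHJ (max M MT) a hcJ hBT hρR hM' ha1 hρ htHJ
  have hM'' : 0 < max (max M MT) MH := lt_max_of_lt_left hM'
  have htHJ0 : 0 ≤ tHJ := by
    have h2 := rowConst261_nonneg (geo9Y (d := θ.d₆) (ℓ := θ.ℓ₆) (hd := θ.hd') (hL := θ.hL') (b₀ := θ.b₀) (b₁ := θ.b₁) (Mstar := Mstar)) ρR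
    exact le_trans (by positivity) htHJ
  obtain ⟨ML, hsup⟩ := hD2sup_of_form_schemas_wRPQ_J q hq H f 𝔠 𝔮 𝔮s parT R₁ R₂ c 𝔬12 bI hblk12 wC (fun x c => (WC x c * (geo9Y x).len c ^ 2) * ((geo9Y x).len c ^ 3)⁻¹) hwC
    (fun x c => mul_nonneg (mul_nonneg (hWC x c) (pow_nonneg (geo9Y_len_pos x c).le 2)) (inv_nonneg.mpr (pow_nonneg (geo9Y_len_pos x c).le 3))) hww
    κC δC tHJ ρR δ₂ θ₂ (max (max M MT) MH) a hκC htHJ0 hρR hδ₂ hM'' hδC hθ₂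
    (fun x hMx α₀ hα ha U hU hU' => hC2 x ((le_max_left _ _).trans ((le_max_left _ _).trans hMx)) α₀ hα ha U hU hU')
    (fun j hMx α₀ hα ha U hU hU' c => hHJ (f j) ((le_max_right _ _).trans hMx) ((le_max_left _ _).trans hMx) α₀ hα ha U
      (hHT j ((le_max_right _ _).trans ((le_max_left _ _).trans hMx)) ((le_max_left _ _).trans ((le_max_left _ _).trans hMx)) α₀ hα ha U hU hU')
      (hreg (f j) ((le_max_left _ _).trans ((le_max_left _ _).trans hMx)) α₀ hα ha U hU hU') c)
  exact ⟨max ML (max (max M MT) MH), fun j hMx hMM α₀ hα ha U hU hU' =>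
    hsup j ((le_max_left _ _).trans hMx) (max_le (max_le hMM ((le_max_right _ _).trans ((le_max_left _ _).trans ((le_max_right _ _).trans hMx))))
      ((le_max_right _ _).trans ((le_max_right _ _).trans hMx))) α₀ hα ha U hU hU'⟩

end Summit.QuantumFields.YangMills.BalabanUVNodes.N06Delta2AtPinsPhysPQJ

end
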